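import Summits.CriticalPhenomena.PercolationContinuityZ3.Theorems.SahiMasterFamilyStructHull

/-!
# Structure theory of the zero-flag class, II: good chains, structured families, the safe region

Unit `prim-master-conj` (crux anchor stmt-CriticalPhenomena-4575); STRUCTURE-THEORY.md §2 (gen 6).  A family of events is a map
`U : κ → Set (Set ι)` together with a finite set of indices; a CHAIN is a list of indices, read from the LAST member (head) to the
first (so that structural recursion on lists peels the last member).  Along a chain every member `v` gets a FRAME
`hull (frameSupp U l) (U v)` — its hull over the frame coordinates `frameSupp U l` of the members before it — and an ANNIHILATOR
(frame minus member).  The chain is GOOD (`GoodChain U l`) if every annihilator lies in the SAFE REGION of the preceding family: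
the configurations `φ` failing at least two preceding members and such that every preceding sub-family containing all members failing
at `φ` is itself STRUCTURED (= enumerated by some good chain).  This is one well-founded recursion on the length (`GoodChain`), after
which `Structured`, `failSet`, `Safe` are introduced and the defining clause is restated as `goodChain_cons`.  Also: frames of members
inside a chain (`frameIn`), their basic algebra (supports of frames are pairwise disjoint and make up `frameSupp`, STRUCTURE-THEORY L2),
good chains of length ≤ 2 (`structured_singleton`, `goodChain_pair_iff`).  Pure combinatorics; axioms standard. [this work]
-/

noncomputable section

open scoped Classical

namespace Summit.CriticalPhenomena.PercolationContinuityZ3.Theorems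

open Finset Function
open Literature.Probability.LatticeModels.Kahn2022 (Affects)

variable {ι : Type*} [Fintype ι] {κ : Type*}

/-! ### Frames along a chain and good chains -/

/-- **Frame support of a chain** (head = last member): the union of the essential supports of the frames of its members, each
frame being the hull of the member over the frame support of the members before it. [this work] -/
def frameSupp (U : κ → Set (Set ι)) : List κ → Set ι
  | [] => ∅
  | v :: l => frameSupp U l ∪ ↑(esupp (hull (frameSupp U l) (U v)))

/-- **Good chains** (STRUCTURE-THEORY §2; head = last member).  `[]` is good; `v :: l` is good iff `l` is good, `v ∉ l`, and every
configuration of the annihilator `hull (frameSupp U l) (U v) ∖ U v` of `v` is SAFE for the family `l`: it fails at least two members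
of `l`, and every sub-family of `l` containing all the members it fails is enumerated by a good chain.  (One well-founded recursion on
the length; the redundant length bound in the last clause is what makes the recursion structural — see `goodChain_cons`.) [this work] -/
def GoodChain (U : κ → Set (Set ι)) : List κ → Prop
  | [] => True
  | v :: l => GoodChain U l ∧ v ∉ l ∧
      ∀ φ : Set ι, φ ∈ hull (frameSupp U l) (U v) → φ ∉ U v →
        2 ≤ (l.toFinset.filter fun w => φ ∉ U w).card ∧
          ∀ R : Finset κ, (l.toFinset.filter fun w => φ ∉ U w) ⊆ R → R ⊆ l.toFinset →
            ∃ l' : List κ, ∃ _ : l'.length ≤ l.length, l'.toFinset = R ∧ GoodChain U l'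
termination_by l => l.length
decreasing_by all_goals simp_wf <;> omega

/-- **Structured families**: a finite family of indices is structured iff some enumeration of it is a good chain. [this work] -/
def Structured (U : κ → Set (Set ι)) (W : Finset κ) : Prop := ∃ l : List κ, l.toFinset = W ∧ GoodChain U l

/-- The members of `W` failing at the configuration `φ` (`R_φ(W)` of STRUCTURE-THEORY). [this work] -/
def failSet (U : κ → Set (Set ι)) (W : Finset κ) (φ : Set ι) : Finset κ := W.filter fun w => φ ∉ U w

/-- **The safe region** of a family: configurations failing at least two members such that every sub-family containing all failed
members is structured.  Its complement is the critical region `Crit`. [this work] -/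
def Safe (U : κ → Set (Set ι)) (W : Finset κ) : Set (Set ι) :=
  {φ | 2 ≤ (failSet U W φ).card ∧ ∀ R : Finset κ, failSet U W φ ⊆ R → R ⊆ W → Structured U R}

/-- **Frame of a member inside a chain**: the hull of the member over the frame support of the members before it
(junk `U w` if `w` is not in the chain). [this work] -/
def frameIn (U : κ → Set (Set ι)) : List κ → κ → Set (Set ι)
  | [], w => U w
  | v :: l, w => if w = v then hull (frameSupp U l) (U v) else frameIn U l w

section Basic

variable (U : κ → Set (Set ι))

omit [Fintype ι] in
/-- Membership in the fail set. [this work] -/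
@[simp] theorem mem_failSet {W : Finset κ} {φ : Set ι} {w : κ} : w ∈ failSet U W φ ↔ w ∈ W ∧ φ ∉ U w := by
  simp [failSet]

omit [Fintype ι] in
/-- The fail set is a sub-family. [this work] -/
theorem failSet_subset (W : Finset κ) (φ : Set ι) : failSet U W φ ⊆ W := filter_subset _ _

/-- Membership in the safe region. [this work] -/
theorem mem_safe {W : Finset κ} {φ : Set ι} :
    φ ∈ Safe U W ↔ 2 ≤ (failSet U W φ).card ∧ ∀ R : Finset κ, failSet U W φ ⊆ R → R ⊆ W → Structured U R := Iff.rfl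

/-- The empty chain is good. [this work] -/
@[simp] theorem goodChain_nil : GoodChain U ([] : List κ) := by
  unfold GoodChain; trivial

/-- A good chain has no repeated index. [this work] -/
theorem GoodChain.nodup : ∀ {l : List κ}, GoodChain U l → l.Nodup
  | [], _ => List.nodup_nil
  | v :: l, h => by
    unfold GoodChain at h
    exact List.nodup_cons.2 ⟨h.2.1, GoodChain.nodup h.1⟩

/-- The tail of a good chain is good. [this work] -/
theorem GoodChain.tail {v : κ} {l : List κ} (h : GoodChain U (v :: l)) : GoodChain U l := by
  unfold GoodChain at h; exact h.1

/-- A list enumerating a finset without repetition has the cardinality as length. [folklore] -/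
theorem length_eq_card_of_toFinset_eq {l : List κ} (hl : l.Nodup) {W : Finset κ} (hW : l.toFinset = W) : l.length = W.card := by
  rw [← hW, List.toFinset_card_of_nodup hl]

/-- **The defining clause of a good chain, restated**: `v :: l` is good iff `l` is good, `v ∉ l`, and the annihilator of `v` over `l`
lies in the safe region of `l`. [this work] -/
theorem goodChain_cons {v : κ} {l : List κ} :
    GoodChain U (v :: l) ↔ GoodChain U l ∧ v ∉ l ∧ hull (frameSupp U l) (U v) \ U v ⊆ Safe U l.toFinset := by
  constructor
  · intro h
    unfold GoodChain at h
    obtain ⟨hl, hv, hs⟩ := h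
    refine ⟨hl, hv, fun φ hφ => ?_⟩
    obtain ⟨h2, hR⟩ := hs φ hφ.1 hφ.2
    refine ⟨by simpa [failSet] using h2, fun R h1 h2' => ?_⟩
    obtain ⟨l', -, hl'R, hl'⟩ := hR R (by simpa [failSet] using h1) h2'
    exact ⟨l', hl'R, hl'⟩
  · rintro ⟨hl, hv, hs⟩
    unfold GoodChain
    refine ⟨hl, hv, fun φ h1 h2 => ?_⟩
    obtain ⟨hc, hR⟩ := hs ⟨h1, h2⟩
    refine ⟨by simpa [failSet] using hc, fun R hR1 hR2 => ?_⟩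
    obtain ⟨l', hl'R, hl'⟩ := hR R (by simpa [failSet] using hR1) hR2
    refine ⟨l', ?_, hl'R, hl'⟩
    rw [length_eq_card_of_toFinset_eq (GoodChain.nodup U hl') hl'R]
    exact (card_le_card hR2).trans (List.toFinset_card_le l)

/-- A structured family is enumerated by a good chain without repetition, of length its cardinality. [this work] -/
theorem Structured.exists_chain {W : Finset κ} (h : Structured U W) :
    ∃ l : List κ, l.toFinset = W ∧ l.Nodup ∧ l.length = W.card ∧ GoodChain U l := by
  obtain ⟨l, hlW, hl⟩ := h
  exact ⟨l, hlW, GoodChain.nodup U hl, length_eq_card_of_toFinset_eq (GoodChain.nodup U hl) hlW, hl⟩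

/-- A good chain enumerates a structured family. [this work] -/
theorem GoodChain.structured {l : List κ} (h : GoodChain U l) : Structured U l.toFinset := ⟨l, rfl, h⟩

/-- **Singletons are structured** (a chain of length one has no condition). [this work] -/
theorem structured_singleton (v : κ) : Structured U ({v} : Finset κ) := by
  refine ⟨[v], by simp, ?_⟩
  rw [goodChain_cons]
  refine ⟨goodChain_nil U, by simp, ?_⟩
  intro φ hφ
  -- over the empty chain the frame support is empty, so the annihilator is empty
  simp only [frameSupp, hull_empty] at hφ
  exact absurd hφ.1 hφ.2

/-- The safe region of a family with at most one member is empty. [this work] -/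
theorem safe_eq_empty_of_card_le_one {W : Finset κ} (hW : W.card ≤ 1) : Safe U W = ∅ := by
  ext φ
  refine ⟨fun h => ?_, fun h => absurd h (Set.notMem_empty φ)⟩
  have h2 := (mem_safe U).1 h
  have h3 := (card_le_card (failSet_subset U W φ)).trans hW
  omega

/-! ### Frames: basic algebra (STRUCTURE-THEORY L2) -/

/-- The frame of the head. [this work] -/
@[simp] theorem frameIn_cons_self (v : κ) (l : List κ) : frameIn U (v :: l) v = hull (frameSupp U l) (U v) := by
  simp [frameIn]

/-- The frame of a non-head member is its frame in the tail. [this work] -/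
theorem frameIn_cons_of_ne {v w : κ} (h : w ≠ v) (l : List κ) : frameIn U (v :: l) w = frameIn U l w := by
  simp [frameIn, h]

/-- The frame support of a cons. [this work] -/
theorem frameSupp_cons (v : κ) (l : List κ) :
    frameSupp U (v :: l) = frameSupp U l ∪ ↑(esupp (frameIn U (v :: l) v)) := by
  simp [frameSupp, frameIn]

/-- **The frame support is the union of the supports of the frames of the members.** [this work] -/
theorem frameSupp_eq_biUnion : ∀ {l : List κ}, l.Nodup →
    frameSupp U l = ⋃ w ∈ l.toFinset, (↑(esupp (frameIn U l w)) : Set ι)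
  | [], _ => by simp [frameSupp]
  | v :: l, hn => by
    have hv : v ∉ l := (List.nodup_cons.1 hn).1
    rw [frameSupp_cons, frameSupp_eq_biUnion (List.nodup_cons.1 hn).2, List.toFinset_cons, set_biUnion_insert,
      Set.union_comm]
    congr 1
    refine Set.iUnion₂_congr fun w hw => ?_
    rw [frameIn_cons_of_ne U (fun h : w = v => hv (h ▸ List.mem_toFinset.1 hw))]

/-- The frame of a member is an increasing event (members increasing). [this work] -/
theorem isUpperSet_frameIn (hU : ∀ k, IsUpperSet (U k)) : ∀ (l : List κ) (w : κ), IsUpperSet (frameIn U l w)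
  | [], w => by simpa [frameIn] using hU w
  | v :: l, w => by
    by_cases h : w = v
    · subst h; rw [frameIn_cons_self]; exact isUpperSet_hull (hU w) _
    · rw [frameIn_cons_of_ne U h]; exact isUpperSet_frameIn hU l w

/-- A member lies in its frame. [this work] -/
theorem subset_frameIn (hU : ∀ k, IsUpperSet (U k)) : ∀ (l : List κ) (w : κ), U w ⊆ frameIn U l w
  | [], w => by simp [frameIn]
  | v :: l, w => by
    by_cases h : w = v
    · subst h; rw [frameIn_cons_self]; exact subset_hull (hU w) _
    · rw [frameIn_cons_of_ne U h]; exact subset_frameIn hU l w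

/-- Frames are nonempty (members nonempty). [this work] -/
theorem frameIn_nonempty (hU : ∀ k, IsUpperSet (U k)) (hne : ∀ k, (U k).Nonempty) (l : List κ) (w : κ) :
    (frameIn U l w).Nonempty :=
  (hne w).mono (subset_frameIn U hU l w)

/-- **The support of the head's frame misses the frame support of the tail** (STRUCTURE-THEORY L2(a)). [this work] -/
theorem disjoint_frameSupp_esupp_frameIn_head (v : κ) (l : List κ) :
    Disjoint (frameSupp U l) ↑(esupp (frameIn U (v :: l) v)) := by
  rw [frameIn_cons_self, Set.disjoint_left]
  intro e he heA
  exact not_affects_hull (U v) he (mem_esupp.1 (mem_coe.1 heA))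

/-- The support of any member's frame lies in the frame support of the chain. [this work] -/
theorem esupp_frameIn_subset_frameSupp : ∀ {l : List κ} {w : κ}, w ∈ l →
    (↑(esupp (frameIn U l w)) : Set ι) ⊆ frameSupp U l
  | [], w, hw => absurd hw List.not_mem_nil
  | v :: l, w, hw => by
    by_cases h : w = v
    · subst h; rw [frameSupp_cons]; exact Set.subset_union_right
    · rw [frameIn_cons_of_ne U h, frameSupp_cons]
      exact (esupp_frameIn_subset_frameSupp (List.mem_of_ne_of_mem h hw)).trans Set.subset_union_left

/-- **The supports of the frames of a chain are pairwise disjoint** (STRUCTURE-THEORY L2(a)). [this work] -/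
theorem disjoint_esupp_frameIn : ∀ {l : List κ}, l.Nodup → ∀ {w w' : κ}, w ∈ l → w' ∈ l → w ≠ w' →
    Disjoint (esupp (frameIn U l w)) (esupp (frameIn U l w'))
  | [], _, w, w', hw, _, _ => absurd hw List.not_mem_nil
  | v :: l, hn, w, w', hw, hw', hne => by
    have hv : v ∉ l := (List.nodup_cons.1 hn).1
    have key : ∀ u ∈ l, Disjoint (esupp (frameIn U (v :: l) u)) (esupp (frameIn U (v :: l) v)) := by
      intro u hu
      have hu' : u ≠ v := fun h => hv (h ▸ hu)
      rw [frameIn_cons_of_ne U hu']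
      refine Finset.disjoint_left.2 fun e he he' => ?_
      exact Set.disjoint_left.1 (disjoint_frameSupp_esupp_frameIn_head U v l)
        (esupp_frameIn_subset_frameSupp U hu (mem_coe.2 he)) (mem_coe.2 he')
    by_cases h : w = v
    · subst h
      have hw'l : w' ∈ l := List.mem_of_ne_of_mem (Ne.symm hne) hw'
      exact (key w' hw'l).symm
    · by_cases h' : w' = v
      · subst h'
        exact key w (List.mem_of_ne_of_mem h hw)
      · rw [frameIn_cons_of_ne U h, frameIn_cons_of_ne U h']
        exact disjoint_esupp_frameIn (List.nodup_cons.1 hn).2 (List.mem_of_ne_of_mem h hw)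
          (List.mem_of_ne_of_mem h' hw') hne

/-- **A frame is its member's hull over any set of coordinates between "the earlier blocks" and "everything but its own block"**
(STRUCTURE-THEORY L2(b)): for `w ∈ l` and `frameSupp`-of-the-tail-below-`w` ⊆ `S'`, `S'` disjoint from the block of `w`,
`hull S' (U w) = frameIn U l w`.  Stated for the head. [this work] -/
theorem hull_eq_frameIn_head (hU : ∀ k, IsUpperSet (U k)) (v : κ) (l : List κ) {S' : Set ι} (h1 : frameSupp U l ⊆ S')
    (h2 : Disjoint S' ↑(esupp (frameIn U (v :: l) v))) : hull S' (U v) = frameIn U (v :: l) v := by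
  rw [frameIn_cons_self] at h2 ⊢
  refine Set.Subset.antisymm (fun ω hω => ?_) (hull_mono_left (hU v) h1)
  -- `ω ∪ S' ∈ U v ⊆ hull _ (U v)`, and the hull ignores `S'`
  have h3 : ω ∪ S' ∈ hull (frameSupp U l) (U v) := subset_hull (hU v) _ hω
  have h4 : hull S' (hull (frameSupp U l) (U v)) = hull (frameSupp U l) (U v) :=
    hull_eq_self_of_disjoint (isUpperSet_hull (hU v) _) h2
  rw [← h4]
  exact h3

/-- **Turning on the earlier frame coordinates moves a frame configuration into the member** (STRUCTURE-THEORY L2(c)). [this work] -/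
theorem union_frameSupp_mem_of_mem_frameIn_head (v : κ) (l : List κ) {ω : Set ι} (h : ω ∈ frameIn U (v :: l) v) :
    ω ∪ frameSupp U l ∈ U v := by
  rw [frameIn_cons_self] at h; exact h

/-! ### Chains of length two -/

/-- The frame support of a singleton chain is the support of its member. [this work] -/
theorem frameSupp_singleton (v : κ) : frameSupp U [v] = ↑(esupp (U v)) := by
  simp [frameSupp]

/-- **Good chains of length two are the pairs with disjoint supports** (STRUCTURE-THEORY §2). [this work] -/
theorem goodChain_pair_iff (hU : ∀ k, IsUpperSet (U k)) {v w : κ} (hvw : v ≠ w) :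
    GoodChain U [v, w] ↔ Disjoint (esupp (U v)) (esupp (U w)) := by
  rw [goodChain_cons]
  have hw : GoodChain U [w] := by
    obtain ⟨l, hl, hgl⟩ := structured_singleton U w
    have : l = [w] := by
      have hn := GoodChain.nodup U hgl
      have hlen := length_eq_card_of_toFinset_eq hn hl
      rw [card_singleton] at hlen
      obtain ⟨a, rfl⟩ := List.length_eq_one_iff.1 hlen
      simp only [List.toFinset_cons, List.toFinset_nil, insert_empty_eq, singleton_inj] at hl
      rw [hl]
    rwa [this] at hgl
  have hsafe : Safe U ([w] : List κ).toFinset = ∅ := safe_eq_empty_of_card_le_one U (by simp)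
  simp only [hw, List.mem_singleton, hvw, not_false_eq_true, true_and, hsafe, Set.sdiff_subset_iff, Set.union_empty,
    frameSupp_singleton]
  constructor
  · intro h
    -- `hull (esupp (U w)) (U v) ⊆ U v` means no coordinate of `esupp (U w)` acts on `U v`
    refine Finset.disjoint_left.2 fun e hev hew => ?_
    obtain ⟨ω, hω, heω⟩ := mem_esupp.1 hev
    apply hω
    apply h
    rw [mem_hull]
    refine hU v ?_ heω
    intro i hi
    rcases Set.mem_insert_iff.1 hi with rfl | hi
    · exact Set.mem_union_right _ (mem_coe.2 hew)
    · exact Set.mem_union_left _ hi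
  · intro h
    rw [hull_eq_self_of_disjoint (hU v) (by simpa [Set.disjoint_left, Finset.disjoint_left] using h.symm)]

end Basic

end Summit.CriticalPhenomena.PercolationContinuityZ3.Theorems
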